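import Summits.QuantumFields.YangMills.Theorems.ToronCumulantSignInnerMoment
import HarnessLib

/-!
# Route `ToronCumulantSign`, crux `OneSiteCovDerivative` (stmt-QuantumFields-27531) — helper III:
# the commutator energy `R(X,Y) = Re tr(XYX⁻¹Y⁻¹)` on `SU(N)` and the iterated Haar integrals of the one-site cumulant

With `R(X,Y) = Re tr(X Y X⁻¹ Y⁻¹)` (the one-site plaquette energy, `plaquetteHolonomy_oneSite`) and `w(X) = |tr X|²` on `SU(N)`,
`N = 2 + n ≥ 2`: `R(X,Y) = R(Y,X)`; the Schur integrals `∫ R(X,Y) dY = w(X)/N = ∫ R(Y,X) dY` (helper `integral_traceConj`);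
and the purely formal reductions of the fourfold iterated integrals that occur in the first `β`-cumulant of the one-site
complementary-plane covariance: for "readers" `A, B : G → G → ℝ` with `∫ A(x,x') dx' = w(x)/N`, `∫ B(y,y') dy' = w(y)/N`,
  `∫∫∫∫ A(x,x') B(y,y') R(x,y) = N⁻² ∫∫ w(x) w(y) R(x,y)`,  `∫∫∫∫ A(x,x') R(x,y) = N⁻¹ ∫∫ w(x) R(x,y)`,
  `∫∫∫∫ B(y,y') R(x,y) = N⁻¹ ∫∫ w(y) R(x,y)`,  `∫∫∫∫ R(x,y) = ∫∫ R(x,y)`, and the in-plane factorizations.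
HONEST LABEL: bookkeeping toward the OPEN crux `OneSiteCovDerivative`; nothing about the Yang–Mills mass gap.

References: Yu. Makeenko, *Methods of contemporary gauge theory* §14.3 (the one-site / Eguchi–Kawai model); M. Creutz,
*Quarks, gluons and lattices* (1983) §8.
-/

noncomputable section

open MeasureTheory Complex
open Literature.MathematicalPhysics.QuantumLattice Literature.MathematicalPhysics.QuantumFieldTheory

namespace Summit.QuantumFields.YangMills.Theorems.ToronCumulantSign

open Summit.Ventures.YMGap

section OneSite

variable {n : ℕ}

/-- Local shorthand: `SU(2+n)`. -/
local notation3 (prettyPrint := false) "SUn" => Matrix.specialUnitaryGroup (Fin (2 + n)) ℂ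

/-- Local shorthand: the underlying matrix. -/
local notation3 (prettyPrint := false) "↑ₘ" X:max => ((X : SUn) : Matrix (Fin (2 + n)) (Fin (2 + n)) ℂ)

/-- Local shorthand: the commutator energy `R(X,Y) = Re tr(X Y X⁻¹ Y⁻¹)`. -/
local notation3 (prettyPrint := false) "R" X:max Y:max =>
  (((X * Y * X⁻¹ * Y⁻¹ : SUn) : Matrix (Fin (2 + n)) (Fin (2 + n)) ℂ).trace.re : ℝ)

/-- Local shorthand: `w(X) = |tr X|²`. -/
local notation3 (prettyPrint := false) "w" X:max => (Complex.normSq (Matrix.trace (↑ₘ X)) : ℝ)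

/-- Local shorthand: Haar probability on `SU(2+n)`. -/
local notation3 (prettyPrint := false) "dH" => haarProbability (Matrix.specialUnitaryGroup (Fin (2 + n)) ℂ)

/-- The commutator read in matrices. [folklore] -/
theorem coe_comm (X Y : SUn) : ((X * Y * X⁻¹ * Y⁻¹ : SUn) : Matrix (Fin (2 + n)) (Fin (2 + n)) ℂ) =
    ↑ₘ X * ↑ₘ Y * (↑ₘ X).conjTranspose * (↑ₘ Y).conjTranspose := rfl

/-- **Symmetry of the commutator energy**: `Re tr(XYX⁻¹Y⁻¹) = Re tr(YXY⁻¹X⁻¹)` (`[Y,X] = [X,Y]†`). [folklore] -/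
theorem R_symm (X Y : SUn) : R X Y = R Y X := by
  rw [coe_comm, coe_comm]
  have h : (↑ₘ Y * ↑ₘ X * (↑ₘ Y).conjTranspose * (↑ₘ X).conjTranspose) =
      (↑ₘ X * ↑ₘ Y * (↑ₘ X).conjTranspose * (↑ₘ Y).conjTranspose).conjTranspose := by
    simp only [Matrix.conjTranspose_mul, Matrix.conjTranspose_conjTranspose, Matrix.mul_assoc]
  rw [h, Matrix.trace_conjTranspose, Complex.star_def, Complex.conj_re]

/-- Continuity of `(X, Y) ↦ R(X,Y)`. [folklore] -/
theorem continuous_R : Continuous fun z : SUn × SUn => R z.1 z.2 := by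
  have h : Continuous fun z : SUn × SUn => (z.1 * z.2 * z.1⁻¹ * z.2⁻¹ : SUn) := by fun_prop
  exact Complex.continuous_re.comp (continuous_id.matrix_trace.comp (continuous_subtype_val.comp h))

/-- Continuity of `Y ↦ R(X,Y)` for fixed `X`. [folklore] -/
theorem continuous_R_right (X : SUn) : Continuous fun Y : SUn => R X Y := by
  have h : Continuous fun Y : SUn => (X * Y * X⁻¹ * Y⁻¹ : SUn) := by fun_prop
  exact Complex.continuous_re.comp (continuous_id.matrix_trace.comp (continuous_subtype_val.comp h))

/-- Continuity of `X ↦ w(X) = |tr X|²`. [folklore] -/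
theorem continuous_w : Continuous fun X : SUn => w X :=
  Complex.continuous_normSq.comp (continuous_id.matrix_trace.comp continuous_subtype_val)

/-- ★ **Schur integral over the second argument**: `∫ R(X,Y) dY = |tr X|²/N`. [folklore] -/
theorem integral_R_right (X : SUn) : ∫ Y, R X Y ∂dH = w X / (2 + n : ℝ) := by
  have hρ := TorusAreaLaw.isSpecialUnitaryModel_fundamentalRep (2 + n)
  have h := integral_traceConj (fundamentalRep (Fin (2 + n))) hρ (↑ₘ X)
  simp only [fundamentalRep_apply] at h
  have hc : Continuous fun Y : SUn => (↑ₘ X * ↑ₘ Y * (↑ₘ X).conjTranspose * (↑ₘ Y).conjTranspose).trace :=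
    continuous_id.matrix_trace.comp (((continuous_const.mul continuous_subtype_val).mul continuous_const).mul
      (continuous_id.matrix_conjTranspose.comp continuous_subtype_val))
  have hint : Integrable (fun Y : SUn => (↑ₘ X * ↑ₘ Y * (↑ₘ X).conjTranspose * (↑ₘ Y).conjTranspose).trace) dH :=
    hc.integrable_of_hasCompactSupport (HasCompactSupport.of_compactSpace _)
  have hre := integral_re hint
  simp only [RCLike.re_to_complex] at hre
  simp_rw [coe_comm]
  rw [hre, h]
  have e : ((2 + n : ℕ) : ℂ)⁻¹ * ((w X : ℝ) : ℂ) = (((w X / (2 + n : ℝ)) : ℝ) : ℂ) := by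
    push_cast
    ring
  rw [e, Complex.ofReal_re]

/-- ★ **Schur integral over the first argument**: `∫ R(X,Y) dX = |tr Y|²/N`. [folklore] -/
theorem integral_R_left (Y : SUn) : ∫ X, R X Y ∂dH = w Y / (2 + n : ℝ) := by
  simp_rw [R_symm _ Y]
  exact integral_R_right Y

/-- `∫ |tr X|² dX = 1`. [folklore] -/
theorem integral_w : ∫ X, w X ∂dH = 1 :=
  RobustBall.HaarSecondMoments.integral_normSq_trace_suN (N := 2 + n) (by omega)

/-- **`∫∫ R = 1/N`.** [folklore] -/
theorem integral_integral_R : ∫ X, ∫ Y, R X Y ∂dH ∂dH = 1 / (2 + n : ℝ) := by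
  simp_rw [integral_R_right]
  rw [integral_div, integral_w]

/-! ### Formal reductions of the fourfold iterated integrals -/

/-- Mixed plane, term `E[P Q P_p]`: `∫∫∫∫ A(x,x') B(y,y') R(x,y) = N⁻² ∫∫ w(x) w(y) R(x,y)`. [folklore] -/
theorem iter_mixed_PQR (A B : SUn → SUn → ℝ) (hA : ∀ x, ∫ x', A x x' ∂dH = w x / (2 + n : ℝ))
    (hB : ∀ y, ∫ y', B y y' ∂dH = w y / (2 + n : ℝ)) :
    ∫ x, ∫ x', ∫ y, ∫ y', A x x' * B y y' * R x y ∂dH ∂dH ∂dH ∂dH =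
      (1 / (2 + n : ℝ)) ^ 2 * ∫ x, ∫ y, w x * w y * R x y ∂dH ∂dH := by
  have h1 : ∀ x x' y, ∫ y', A x x' * B y y' * R x y ∂dH = A x x' * (R x y * (w y / (2 + n : ℝ))) := by
    intro x x' y
    rw [← hB y, ← integral_const_mul, ← integral_const_mul]
    refine integral_congr_ae (ae_of_all _ fun y' => ?_); beta_reduce; ring
  simp_rw [h1, integral_const_mul]
  have h2 : ∀ x, ∫ x', A x x' * ∫ y, R x y * (w y / (2 + n : ℝ)) ∂dH ∂dH =
      (w x / (2 + n : ℝ)) * ∫ y, R x y * (w y / (2 + n : ℝ)) ∂dH := by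
    intro x
    rw [integral_mul_const, hA x]
  simp_rw [h2]
  simp only [← integral_const_mul]
  refine integral_congr_ae (ae_of_all _ fun x => ?_)
  beta_reduce
  refine integral_congr_ae (ae_of_all _ fun y => ?_)
  beta_reduce
  ring

/-- Mixed plane, term `E[P P_p]`: `∫∫∫∫ A(x,x') R(x,y) = N⁻¹ ∫∫ w(x) R(x,y)`. [folklore] -/
theorem iter_mixed_PR (A : SUn → SUn → ℝ) (hA : ∀ x, ∫ x', A x x' ∂dH = w x / (2 + n : ℝ)) :
    ∫ x, ∫ x', ∫ y, ∫ _y' : SUn, A x x' * R x y ∂dH ∂dH ∂dH ∂dH =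
      (1 / (2 + n : ℝ)) * ∫ x, ∫ y, w x * R x y ∂dH ∂dH := by
  have h1 : ∀ x x' y, ∫ _y' : SUn, A x x' * R x y ∂dH = A x x' * R x y := fun x x' y => by
    simp only [integral_const, probReal_univ, one_smul]
  simp_rw [h1, integral_const_mul]
  have h2 : ∀ x, ∫ x', A x x' * ∫ y, R x y ∂dH ∂dH = (w x / (2 + n : ℝ)) * ∫ y, R x y ∂dH := by
    intro x
    rw [integral_mul_const, hA x]
  simp_rw [h2]
  simp only [← integral_const_mul]
  refine integral_congr_ae (ae_of_all _ fun x => ?_)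
  beta_reduce
  refine integral_congr_ae (ae_of_all _ fun y => ?_)
  beta_reduce
  ring

/-- Mixed plane, term `E[Q P_p]`: `∫∫∫∫ B(y,y') R(x,y) = N⁻¹ ∫∫ w(y) R(x,y)`. [folklore] -/
theorem iter_mixed_QR (B : SUn → SUn → ℝ) (hB : ∀ y, ∫ y', B y y' ∂dH = w y / (2 + n : ℝ)) :
    ∫ x, ∫ _x' : SUn, ∫ y, ∫ y', B y y' * R x y ∂dH ∂dH ∂dH ∂dH =
      (1 / (2 + n : ℝ)) * ∫ x, ∫ y, w y * R x y ∂dH ∂dH := by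
  have h1 : ∀ x y, ∫ y', B y y' * R x y ∂dH = R x y * (w y / (2 + n : ℝ)) := by
    intro x y
    rw [integral_mul_const, hB y]; ring
  simp_rw [h1]
  have h2 : ∀ x, ∫ _x' : SUn, ∫ y, R x y * (w y / (2 + n : ℝ)) ∂dH ∂dH = ∫ y, R x y * (w y / (2 + n : ℝ)) ∂dH :=
    fun x => by simp only [integral_const, probReal_univ, one_smul]
  simp_rw [h2]
  simp only [← integral_const_mul]
  refine integral_congr_ae (ae_of_all _ fun x => ?_)
  beta_reduce
  refine integral_congr_ae (ae_of_all _ fun y => ?_)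
  beta_reduce
  ring

/-- Mixed plane, term `E[P_p]`: `∫∫∫∫ R(x,y) = ∫∫ R(x,y)`. [folklore] -/
theorem iter_mixed_R :
    ∫ x, ∫ _x' : SUn, ∫ y, ∫ _y' : SUn, R x y ∂dH ∂dH ∂dH ∂dH = ∫ x, ∫ y, R x y ∂dH ∂dH := by
  have h1 : ∀ x y, ∫ _y' : SUn, R x y ∂dH = R x y := fun x y => by simp only [integral_const, probReal_univ, one_smul]
  simp_rw [h1]
  refine integral_congr_ae (ae_of_all _ fun x => ?_)
  beta_reduce
  simp only [integral_const, probReal_univ, one_smul]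

/-- Term `E[P Q]`: `∫∫∫∫ A(x,x') B(y,y') = N⁻²` (independence of the two planes). [folklore] -/
theorem iter_PQ (A B : SUn → SUn → ℝ) (hA : ∀ x, ∫ x', A x x' ∂dH = w x / (2 + n : ℝ))
    (hB : ∀ y, ∫ y', B y y' ∂dH = w y / (2 + n : ℝ)) :
    ∫ x, ∫ x', ∫ y, ∫ y', A x x' * B y y' ∂dH ∂dH ∂dH ∂dH = (1 / (2 + n : ℝ)) ^ 2 := by
  have h1 : ∀ x x' y, ∫ y', A x x' * B y y' ∂dH = A x x' * (w y / (2 + n : ℝ)) := by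
    intro x x' y; rw [integral_const_mul, hB y]
  simp_rw [h1, integral_const_mul, integral_div, integral_w, integral_mul_const, hA, integral_div, integral_w]
  ring

/-- Term `E[P]` read through four links: `∫∫∫∫ A(x,x') = N⁻¹`. [folklore] -/
theorem iter_P (A : SUn → SUn → ℝ) (hA : ∀ x, ∫ x', A x x' ∂dH = w x / (2 + n : ℝ)) :
    ∫ x, ∫ x', ∫ _y : SUn, ∫ _y' : SUn, A x x' ∂dH ∂dH ∂dH ∂dH = 1 / (2 + n : ℝ) := by
  have h1 : ∀ x x', ∫ _y : SUn, ∫ _y' : SUn, A x x' ∂dH ∂dH = A x x' := fun x x' => by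
    simp only [integral_const, probReal_univ, one_smul]
  simp_rw [h1, hA, integral_div, integral_w]

/-- Term `E[Q]` read through four links: `∫∫∫∫ B(y,y') = N⁻¹`. [folklore] -/
theorem iter_Q (B : SUn → SUn → ℝ) (hB : ∀ y, ∫ y', B y y' ∂dH = w y / (2 + n : ℝ)) :
    ∫ _x : SUn, ∫ _x' : SUn, ∫ y, ∫ y', B y y' ∂dH ∂dH ∂dH ∂dH = 1 / (2 + n : ℝ) := by
  simp_rw [hB, integral_div, integral_w]
  simp only [integral_const, probReal_univ, one_smul]

/-- In-plane, term `E[P Q P]`: `∫∫∫∫ A(x,x') B(y,y') A(x,x') = N⁻¹ ∫∫ A²`. [folklore] -/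
theorem iter_PQP (A B : SUn → SUn → ℝ) (hB : ∀ y, ∫ y', B y y' ∂dH = w y / (2 + n : ℝ)) :
    ∫ x, ∫ x', ∫ y, ∫ y', A x x' * B y y' * A x x' ∂dH ∂dH ∂dH ∂dH =
      (1 / (2 + n : ℝ)) * ∫ x, ∫ x', A x x' * A x x' ∂dH ∂dH := by
  have h1 : ∀ x x' y, ∫ y', A x x' * B y y' * A x x' ∂dH = A x x' * A x x' * (w y / (2 + n : ℝ)) := by
    intro x x' y
    rw [← hB y, ← integral_const_mul]
    refine integral_congr_ae (ae_of_all _ fun y' => ?_); beta_reduce; ring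
  simp_rw [h1, integral_const_mul, integral_div, integral_w, integral_mul_const]
  ring

/-- In-plane, term `E[P P]` read through four links: `∫∫∫∫ A(x,x') A(x,x') = ∫∫ A²`. [folklore] -/
theorem iter_PP (A : SUn → SUn → ℝ) :
    ∫ x, ∫ x', ∫ _y : SUn, ∫ _y' : SUn, A x x' * A x x' ∂dH ∂dH ∂dH ∂dH = ∫ x, ∫ x', A x x' * A x x' ∂dH ∂dH := by
  have h1 : ∀ x x', ∫ _y : SUn, ∫ _y' : SUn, A x x' * A x x' ∂dH ∂dH = A x x' * A x x' := fun x x' => by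
    simp only [integral_const, probReal_univ, one_smul]
  simp_rw [h1]

/-- In-plane, term `E[P Q Q]`: `∫∫∫∫ A(x,x') B(y,y') B(y,y') = N⁻¹ ∫∫ B²`. [folklore] -/
theorem iter_PQQ (A B : SUn → SUn → ℝ) (hA : ∀ x, ∫ x', A x x' ∂dH = w x / (2 + n : ℝ)) :
    ∫ x, ∫ x', ∫ y, ∫ y', A x x' * B y y' * B y y' ∂dH ∂dH ∂dH ∂dH =
      (1 / (2 + n : ℝ)) * ∫ y, ∫ y', B y y' * B y y' ∂dH ∂dH := by
  have h1 : ∀ x x', ∫ y, ∫ y', A x x' * B y y' * B y y' ∂dH ∂dH = A x x' * ∫ y, ∫ y', B y y' * B y y' ∂dH ∂dH := by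
    intro x x'
    simp only [← integral_const_mul]
    refine integral_congr_ae (ae_of_all _ fun y => ?_)
    beta_reduce
    refine integral_congr_ae (ae_of_all _ fun y' => ?_); beta_reduce; ring
  simp_rw [h1, integral_mul_const, hA, integral_div, integral_w]

/-- In-plane, term `E[Q Q]` read through four links: `∫∫∫∫ B(y,y') B(y,y') = ∫∫ B²`. [folklore] -/
theorem iter_QQ (B : SUn → SUn → ℝ) :
    ∫ _x : SUn, ∫ _x' : SUn, ∫ y, ∫ y', B y y' * B y y' ∂dH ∂dH ∂dH ∂dH = ∫ y, ∫ y', B y y' * B y y' ∂dH ∂dH := by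
  simp only [integral_const, probReal_univ, one_smul]

/-! ### The literal `κ_N` integrand, expanded -/

/-- Integrability of continuous functions on `SU(N)`. [folklore] -/
theorem integrable_of_continuous_su {f : SUn → ℝ} (hf : Continuous f) : Integrable f dH :=
  hf.integrable_of_hasCompactSupport (HasCompactSupport.of_compactSpace _)

/-- `SU(N)` is second countable (a closed subset of a matrix space; restated locally, no instance declared). [folklore] -/
theorem secondCountableTopology_su' : SecondCountableTopology SUn :=
  haveI : SecondCountableTopology (Matrix (Fin (2 + n)) (Fin (2 + n)) ℂ) :=
    inferInstanceAs (SecondCountableTopology (Fin (2 + n) → Fin (2 + n) → ℂ))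
  Topology.IsEmbedding.subtypeVal.secondCountableTopology

/-- Integrability in the first variable of a parametric Haar integral of a continuous function of two variables. [folklore] -/
theorem integrable_parametric {f : SUn → SUn → ℝ} (hf : Continuous (Function.uncurry f)) :
    Integrable (fun x : SUn => ∫ y, f x y ∂dH) dH := by
  haveI := secondCountableTopology_su' (n := n)
  exact (hf.integrable_of_hasCompactSupport (μ := (dH).prod dH) (HasCompactSupport.of_compactSpace _)).integral_prod_left

/-- ★ **Expansion of the crux integral**: `∫∫ (w(x) − 1)(w(y) − 1) R(x,y) = ∫∫ w w R − ∫∫ w(x) R − ∫∫ w(y) R + ∫∫ R`. [folklore] -/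
theorem kappa_expand :
    ∫ x, ∫ y, (w x - 1) * (w y - 1) * R x y ∂dH ∂dH =
      (∫ x, ∫ y, w x * w y * R x y ∂dH ∂dH) - (∫ x, ∫ y, w x * R x y ∂dH ∂dH) -
        (∫ x, ∫ y, w y * R x y ∂dH ∂dH) + ∫ x, ∫ y, R x y ∂dH ∂dH := by
  have hRc : ∀ x : SUn, Continuous fun y : SUn => R x y := continuous_R_right
  have hwc : Continuous fun X : SUn => w X := continuous_w
  -- inner expansion
  have hin : ∀ x, ∫ y, (w x - 1) * (w y - 1) * R x y ∂dH =
      (∫ y, w x * w y * R x y ∂dH) - (∫ y, w x * R x y ∂dH) - (∫ y, w y * R x y ∂dH) + ∫ y, R x y ∂dH := by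
    intro x
    have i1 : Integrable (fun y => w x * w y * R x y) dH :=
      integrable_of_continuous_su ((continuous_const.mul hwc).mul (hRc x))
    have i2 : Integrable (fun y => w x * R x y) dH := integrable_of_continuous_su (continuous_const.mul (hRc x))
    have i3 : Integrable (fun y => w y * R x y) dH := integrable_of_continuous_su (hwc.mul (hRc x))
    have i4 : Integrable (fun y => R x y) dH := integrable_of_continuous_su (hRc x)
    have hpt : ∀ y, (w x - 1) * (w y - 1) * R x y =
        w x * w y * R x y - w x * R x y - w y * R x y + R x y := fun y => by ring
    have i12 : Integrable (fun y => w x * w y * R x y - w x * R x y) dH := i1.sub i2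
    have i123 : Integrable (fun y => w x * w y * R x y - w x * R x y - w y * R x y) dH := i12.sub i3
    simp_rw [hpt]
    rw [integral_add i123 i4, integral_sub i12 i3, integral_sub i1 i2]
  simp_rw [hin]
  -- outer expansion
  have hR2 : Continuous (Function.uncurry fun x y : SUn => R x y) := continuous_R
  have hw1 : Continuous (Function.uncurry fun x _y : SUn => w x) := hwc.comp continuous_fst
  have hw2 : Continuous (Function.uncurry fun _x y : SUn => w y) := hwc.comp continuous_snd
  have j1 : Integrable (fun x => ∫ y, w x * w y * R x y ∂dH) dH :=
    integrable_parametric (f := fun x y => w x * w y * R x y) ((hw1.mul hw2).mul hR2)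
  have j2 : Integrable (fun x => ∫ y, w x * R x y ∂dH) dH :=
    integrable_parametric (f := fun x y => w x * R x y) (hw1.mul hR2)
  have j3 : Integrable (fun x => ∫ y, w y * R x y ∂dH) dH :=
    integrable_parametric (f := fun x y => w y * R x y) (hw2.mul hR2)
  have j4 : Integrable (fun x => ∫ y, R x y ∂dH) dH := integrable_parametric (f := fun x y => R x y) hR2
  have j12 : Integrable (fun x => (∫ y, w x * w y * R x y ∂dH) - ∫ y, w x * R x y ∂dH) dH := j1.sub j2
  have j123 : Integrable (fun x => (∫ y, w x * w y * R x y ∂dH) - (∫ y, w x * R x y ∂dH) - ∫ y, w y * R x y ∂dH) dH :=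
    j12.sub j3
  rw [integral_add j123 j4, integral_sub j12 j3, integral_sub j1 j2]

end OneSite

end Summit.QuantumFields.YangMills.Theorems.ToronCumulantSign
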